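import Summits.CriticalPhenomena.PercolationContinuityZ3.Theorems.PercNearOneGluingNoHeavyPcintMemCertZ2T10Lower
import Summits.CriticalPhenomena.PercolationContinuityZ3.Theorems.PercNearOneGluingNoHeavyPcintClosingDecagonsZ2Exact
import Summits.CriticalPhenomena.PercolationContinuityZ3.Theorems.PercNearOneGluingNoHeavyPcintLoopExclusionRungEightZ3
import Summits.CriticalPhenomena.PercolationContinuityZ3.Theorems.PercNearOneGluingNoHeavyPcintLoopExclusionRungsZ2
import HarnessLib

/-!
# CriticalPhenomena/PercolationContinuityZ3 — Theorems/PercNearOneGluingNoHeavyPcintLoopExclusionRungTenZ2.lean: the FOURTH rung on `ℤ²` — `0.30 ≤ R_10(ℤ²) ≤ 0.32 < 0.35 ≤ R_8(ℤ²)`; and `R_8(ℤ²) < R_8(ℤ³)`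

Lane prim-pcint, STRUCTURE rule.  `f_10(ℤ²) = 560/μ_8¹⁰ ∈ [560/2.7444585¹⁰, 560/2.7444579¹⁰]` (the EXACT count of …ClosingDecagonsZ2Exact,
…MemCertZ2), `Δ_10(ℤ²) ∈ [0.00716, 0.00722]` (…MemCertZ2T10Lower) ⇒ **`loopCompat_ten_zd2_le/ge : 0.30 ≤ R_10(ℤ²) ≤ 0.32`** (measured 0.3112), **`loopCompat_ten_lt_eight_zd2 : R_10(ℤ²) < R_8(ℤ²)`**
(clause (c) at `(2, 4)`), **`loopCompatWindow_two_five`** (clause (a) at `(2, 5)`), and the four-rung chain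
**`loopCompat_chain4_zd2 : R_10(ℤ²) < R_8(ℤ²) < R_6(ℤ²) < R_4(ℤ²) < 1`**; with …RungEightZ3 (`R_8(ℤ³) ≥ 0.52`):
**`loopCompat_eight_zd2_lt_zd3 : R_8(ℤ²) < R_8(ℤ³)`** (clause (b) at the third rung, `(2, 4)`).

HONEST FRAMING: nothing here is used by a certified `p_c` cell.  Written by prim-pcint-2 gen 17 (prover-prim-pcint-2-g17-0), 2026-08-25.
-/

noncomputable section

open Literature.Probability.LatticeModels Literature.Probability.Percolation
open Summit.CriticalPhenomena.PercolationContinuityZ3.Theorems.Pcint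

namespace Summit.CriticalPhenomena.PercolationContinuityZ3.Theorems.Pcint.MemoryTail

/-- **`f_10(ℤ²) ≥ 560/2.7444585¹⁰`** (`≈ 0.023105`). [this work] -/
theorem memLoopDensity_ten_zd2_ge : (560 : ℝ) / 2.7444585 ^ 10 ≤ memLoopDensity 2 10 := by
  unfold memLoopDensity
  rw [show (10 : ℕ) - 2 = 8 from rfl]
  have hμlo : (2.7444579 : ℝ) ≤ memGrowth 2 8 := le_trans (by norm_num) memGrowth_eight_zd2_ge
  have hμhi : memGrowth 2 8 ≤ 2.7444585 := le_trans memGrowth_eight_zd2_le (by norm_num)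
  have hμpos : (0 : ℝ) < memGrowth 2 8 := by linarith
  have hcc : ((closingCount 2 10 : ℕ) : ℝ) = 560 := by rw [closingCount_ten_zd2]; norm_num
  rw [hcc]
  exact div_le_div_of_nonneg_left (by norm_num) (by positivity) (pow_le_pow_left₀ hμpos.le hμhi 10)

/-- **`f_10(ℤ²) ≤ 560/2.7444579¹⁰`**. [this work] -/
theorem memLoopDensity_ten_zd2_le : memLoopDensity 2 10 ≤ (560 : ℝ) / 2.7444579 ^ 10 := by
  unfold memLoopDensity
  rw [show (10 : ℕ) - 2 = 8 from rfl]
  have hμlo : (2.7444579 : ℝ) ≤ memGrowth 2 8 := le_trans (by norm_num) memGrowth_eight_zd2_ge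
  have hcc : ((closingCount 2 10 : ℕ) : ℝ) = 560 := by rw [closingCount_ten_zd2]; norm_num
  rw [hcc]
  exact div_le_div_of_nonneg_left (by norm_num) (by positivity) (pow_le_pow_left₀ (by norm_num) hμlo 10)

/-- `f_10(ℤ²) > 0`. [this work] -/
theorem memLoopDensity_ten_zd2_pos : 0 < memLoopDensity 2 10 :=
  lt_of_lt_of_le (by norm_num) memLoopDensity_ten_zd2_ge

/-- **`R_10(ℤ²) ≤ 0.32`** (measured 0.3112). [this work] -/
theorem loopCompat_ten_zd2_le : loopCompat 2 10 ≤ 0.32 := by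
  unfold loopCompat
  have hf := memLoopDensity_ten_zd2_ge
  have hfpos := memLoopDensity_ten_zd2_pos
  have hΔ := memLoopCost_ten_zd2_bounds.2
  rw [div_le_iff₀ hfpos]
  have : (0.00722 : ℝ) ≤ 0.32 * ((560 : ℝ) / 2.7444585 ^ 10) := by norm_num
  nlinarith

/-- **`0.30 ≤ R_10(ℤ²)`**. [this work] -/
theorem loopCompat_ten_zd2_ge : (0.30 : ℝ) ≤ loopCompat 2 10 := by
  unfold loopCompat
  have hf := memLoopDensity_ten_zd2_le
  have hfpos := memLoopDensity_ten_zd2_pos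
  have hΔ := memLoopCost_ten_zd2_bounds.1
  rw [le_div_iff₀ hfpos]
  have : 0.30 * ((560 : ℝ) / 2.7444579 ^ 10) ≤ 0.00716 := by norm_num
  nlinarith

/-- **`R_10(ℤ²) > 0`**. [this work] -/
theorem loopCompat_ten_zd2_pos : 0 < loopCompat 2 10 := by
  unfold loopCompat
  exact div_pos (lt_of_lt_of_le (by norm_num) memLoopCost_ten_zd2_bounds.1) memLoopDensity_ten_zd2_pos

/-- **`R_10(ℤ²) < R_8(ℤ²)`**: clause (c) of C4 at `(d, m) = (2, 4)`. [this work] -/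
theorem loopCompat_ten_lt_eight_zd2 : loopCompat 2 10 < loopCompat 2 8 :=
  lt_of_le_of_lt loopCompat_ten_zd2_le (lt_of_lt_of_le (by norm_num) loopCompat_eight_zd2_bounds.1)

/-- `loopCompatStrictAntiMemory` at `(2, 4)`. [this work] -/
theorem loopCompatStrictAntiMemory_two_four : loopCompat 2 (2 * 4 + 2) < loopCompat 2 (2 * 4) :=
  loopCompat_ten_lt_eight_zd2

/-- `loopCompatWindow` at `(2, 5)`: `0 < R_10(ℤ²) < 1`. [this work] -/
theorem loopCompatWindow_two_five : 0 < loopCompat 2 (2 * 5) ∧ loopCompat 2 (2 * 5) < 1 :=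
  ⟨loopCompat_ten_zd2_pos, lt_of_le_of_lt loopCompat_ten_zd2_le (by norm_num)⟩

/-- **Four rungs of `ℤ²`, strictly ordered: `R_10(ℤ²) < R_8(ℤ²) < R_6(ℤ²) < R_4(ℤ²) < 1`.** [this work] -/
theorem loopCompat_chain4_zd2 :
    loopCompat 2 10 < loopCompat 2 8 ∧ loopCompat 2 8 < loopCompat 2 6 ∧ loopCompat 2 6 < loopCompat 2 4 ∧ loopCompat 2 4 < 1 :=
  ⟨loopCompat_ten_lt_eight_zd2, loopCompat_chain_zd2⟩

/-- **`R_8(ℤ²) < R_8(ℤ³)`**: clause (b) of C4 at the third rung, `(d, m) = (2, 4)`. [this work] -/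
theorem loopCompat_eight_zd2_lt_zd3 : loopCompat 2 8 < loopCompat 3 8 :=
  lt_of_le_of_lt loopCompat_eight_zd2_bounds.2 (lt_of_lt_of_le (by norm_num) loopCompat_eight_zd3_ge)

/-- `loopCompatStrictMonoDim` at `(2, 4)`. [this work] -/
theorem loopCompatStrictMonoDim_two_four : loopCompat 2 (2 * 4) < loopCompat (2 + 1) (2 * 4) :=
  loopCompat_eight_zd2_lt_zd3

end Summit.CriticalPhenomena.PercolationContinuityZ3.Theorems.Pcint.MemoryTail
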